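import Summits.QuantumFields.BalabanUV.Beta.FP.PerfectLegSwapReflection
import Summits.QuantumFields.BalabanUV.Beta.FP.KernelReflectionBounded
import Summits.QuantumFields.BalabanUV.Beta.FP.CubicGermFunctional

/-!
# `BalabanUV.Beta.FP.LegShiftDictionary` — road «FP» for binder row D1, `RESIDUAL-FP` ROW #22 «LEG CONVENTION (T)↔(Φ)», RULING R-FP-42:
# `Pker` AS TYPED IS THE STRAIGHT PERFECT LEG `Pkerˢˢ` READ IN THE UPPER-ENDPOINT LEG LABELLING — `Pker = refK Ψ Pkerˢˢ` for the sign-free leg relabelling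
# `Ψ : (x, inl α) ↦ x − e_α` — AND THE DICTIONARY THAT CARRIES STRAIGHT GLUON-SECTOR DATA INTO THE ENDs' LETTERS AT `Pker` EXACTLY (no parity, no flip, no re-display)

HONEST DEPENDENCY (page 1, mandatory): continuum YM on T⁴ ⇐ BetaPertH ∧ nine spine estimates (0/9 proved); BetaPertH ⇐ (D1) ∧ (D4) ∧ CAP+tail;
G-an2-4 gates asym, D1 and NE2/3/4.  HONEST FRAMING (cell contract, verbatim): «discharging `BetaPertH` makes Bałaban's UV stability UNCONDITIONAL —
a real constructive-QFT result; it is NOT the continuum limit and NOT the Clay problem.»  THIS MODULE is [folklore] kernel bookkeeping about the road's OWN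
typed objects (`Pker`, `PiBF`, `refK`, `hessKer`, `divV`∕`divW`, `cubicGermOf`); it proves NO estimate of Bałaban's constrained objects, introduces no `def`, no
`def … : Prop`, cites nothing, 0 sorry; 0∕4 row-D1 binders; NOT (Kcov), NOT H2V-4, NOT (ASYMP), NOT D1, NOT BetaPertH, NOT continuum, NOT Clay.

ABSOLUTE RULE (cell charter, verbatim): «No internally-minted statement may enter as a cited fact. Every hypothesis is either kernel-proved in this
package or a verbatim quotation of a PUBLISHED theorem with page reference. The manuscript(s) under audit are NOT citable for their own disputed
steps — they are the thing under adjudication; programme-internal (2001/route/tribunal) claims are never citable.»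

WHY (owner gen 11, journal 2026-08-21 ≈10:33Z, R-FP-42).  beta-d1-formalise-leaf-02-g11 located (R12 `FP/PerfectLegSwapReflection`) that the cell's reflection leg
maps `ResolventReflection.Φ N α` fix the SITE-SWAPPED leg `Pkerˢˢ x z a b := Pker z x a b`, not `Pker` as typed (off-diagonal `Re PinfKer ≠ 0`, DIAG j129771), while the
ENDs of road FP carry the constant `Pker` (`hW1`, `hslice`'s leg, the ledger words, `PiBF` in `hKcov`∕`hgh`).  No re-display is needed: `Pker` is `Pkerˢˢ` relabelled by
the leg map `Ψ` moving a field leg of type `α` from `x` to `x − e_α` (multiplier legs fixed, signs `+1`) — entrywise the BOND-MIDPOINT INVERSION LAW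
`PinfKer α β (−v − e_α + e_β) = PinfKer α β v` (`PinfKer_cflip` composed over the four axes).  A leg relabelling is an automorphism of `comp`∕`tr`∕`tadpole`∕`bubble`
(`KernelReflection.comp_refK`, `KernelReflectionBounded.tadpole_refK_bdd`∕`bubble_refK_bdd`), commutes with `shiftK` and with `KernelWard.divV`∕`divW` (base points
only), moves bi-localisation constants by `e^{2δ}`, preserves zeroth moments and — given `h0V` — the cubic germ.  Hence STRAIGHT gluon data `(V, W, X)` at `Pkerˢˢ`
(leaf-02's R10∕R13, an2's (Sr-conj)∕(Wr-conj-rem)∕K-R5 lane) yield the ENDs' letters at `Pker` for `(Ψ·V, Ψ·W, Ψ·X)`, with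
`PiBF wg wgh (Ψ·V) (Ψ·W) v w μ ν z = wg·hessKer Pkerˢˢ V W μ ν z − wgh·hessKer G0ker v w μ ν z` (same `z`, no flip).

CONTENT (`ℤ⁴`, packed fibre `Fib 3 = Fin 4 ⊕ Fin 4`; `Pkerˢˢ` spelled as the lambda `fun x z a b => Pker z x a b`, as in R12):
* §1 `exists_legShift` (the relabelling as a `KernelReflection.LegMap`), `PinfKer_neg_sub_add` (bond-midpoint inversion), **`refK_legShift_PkerSwap : refK Ψ Pkerˢˢ = Pker`**.
* §2 **`hessKer_Pker_legShift`**, **`PiBF_legShift`**.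
* §3 letter transport: `refK_sub`∕`refK_finset_sum`∕`divV_refK`∕`divW_refK` (any leg map), `shiftK_refK_legShift`, `biLoc_refK_legShift`, `tsum_refK_legShift_eq` (zeroth moments),
  **`cubicGermOf_legShift_of_h0`**, `biLoc_divV`, and the Ward letters **`hW1_legShift`**, **`hW2_legShift`**.
Provenance: road FP OWNER b2b-balaban-beta-d1-p3 gen 11 (prover-b2b-balaban-beta-d1-p3-g11-0), 2026-08-21, `RESIDUAL-FP.md` §12 row #22, ruling R-FP-42.
-/

noncomputable section

namespace Summit.QuantumFields.BalabanUV.Beta.FP.LegShiftDictionary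

open Finset
open scoped BigOperators
open Literature.MathematicalPhysics.QuantumFieldTheory.Balaban1983to89
open Literature.MathematicalPhysics.QuantumFieldTheory.Balaban1983to89.Beta
open B12Sec2to5 (l1 l1_nonneg)
open B6BondElimination (unitVec unitVec_apply)
open PolarizationSign (axisReflect axisReflect_apply axisReflect_axisReflect reflSign)
open ExpKernelCalculus (MKer Site BiLoc comp tr bubble tadpole hessKer shiftK l1_sub_triangle)
open KernelWard (Bdd divV divW summable_slice_bdd_biLoc summable_slice_biLoc_bdd)
open KernelReflection (LegMap refK refK_apply comp_refK)
open OneStepResolventKernel (Fib LocStencil)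
open DyadicShell (Pt)
open Summit.QuantumFields.BalabanUV.Beta.FP.PerfectPropagatorKernel (PinfKer)
open Summit.QuantumFields.BalabanUV.Beta.FP.PerfectPolarization (Pker Pker_inl_inl Pker_inl_inr Pker_inr_inl Pker_inr_inr Pker_translate G0ker PiBF PiBF_def)
open Summit.QuantumFields.BalabanUV.Beta.FP.PerfectPropagatorLegData (A0P)
open Summit.QuantumFields.BalabanUV.Beta.FP.PerfectPolarizationWard (bdd_Pker)
open Summit.QuantumFields.BalabanUV.Beta.FP.PerfectLegSwapReflection (bdd_PkerSwap)
open Summit.QuantumFields.BalabanUV.Beta.FP.PerfectPropagatorReflection (PinfKer_cflip cflip_eq_axisReflect)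
open Summit.QuantumFields.BalabanUV.Beta.FP.KernelReflectionBounded (tadpole_refK_bdd bubble_refK_bdd)
open Summit.QuantumFields.BalabanUV.Beta.FP.WilsonCubicGerm (cubicGermOf)
open Summit.QuantumFields.BalabanUV.Beta.FP.CubicGermFunctional (summable_prod_of_biLoc summable_germSummand)
open Summit.QuantumFields.BalabanUV.Beta.D1BFx.ContactCount (abs_comp_le_of_entryBound)
open Summit.QuantumFields.BalabanUV.Beta.FP.KernelWardBoundedBricks (summable_slice_rl_bdd)

/-! ## §1 The leg-shift relabelling and the bond-midpoint inversion law of the perfect propagator kernel -/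

/-- [folklore] **THE LEG-SHIFT RELABELLING EXISTS** as a `KernelReflection.LegMap`: field legs of type `α` are moved by `x ↦ x − e_α`, multiplier legs are fixed,
every sign is `+1`. -/
theorem exists_legShift :
    ∃ Ψ : LegMap 4 (Fib 3), (∀ (α : Fin 4) (x : Site 4), Ψ.r (Sum.inl α) x = x - unitVec α) ∧
      (∀ (j : Fin 4) (x : Site 4), Ψ.r (Sum.inr j) x = x) ∧ (∀ a : Fib 3, Ψ.s a = 1) := by
  refine ⟨{ r := fun a => match a with
              | Sum.inl α => Equiv.subRight (unitVec α)
              | Sum.inr _ => Equiv.refl _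
            s := fun _ => 1
            s_mul_s := fun _ => one_mul 1 }, fun α x => rfl, fun j x => rfl, fun a => rfl⟩

/-- [folklore] the single-axis law of `PinfKer` in the `axisReflect` spelling with the shifts on the right:
`PinfKer β γ (εy) = ε_β ε_γ · PinfKer β γ (y − [β=α]e_α + [γ=α]e_α)`. -/
theorem PinfKer_axisReflect' (α β γ : Fin 4) (y : Site 4) :
    PinfKer (d := 3) β γ (axisReflect α y)
      = ((reflSign α β * reflSign α γ : ℝ) : ℂ) *
          PinfKer (d := 3) β γ (y - (if β = α then unitVec α else 0) + (if γ = α then unitVec α else 0)) := by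
  rw [← cflip_eq_axisReflect, PinfKer_cflip]
  congr 2
  abel

/-- [folklore] a fixed direction meets exactly one axis: `∏_α ε_α(β) = −1`. -/
theorem prod_reflSign (β : Fin 4) : ∏ α : Fin 4, reflSign α β = -1 := by
  unfold reflSign
  rw [Finset.prod_ite_eq]
  simp

/-- [folklore] the product of the four single-axis signs of a fixed pair of directions is `+1`. -/
theorem prod_reflSign_pair (β γ : Fin 4) : ∏ α : Fin 4, ((reflSign α β * reflSign α γ : ℝ) : ℂ) = 1 := by
  rw [← Complex.ofReal_prod, Finset.prod_mul_distrib, prod_reflSign, prod_reflSign]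
  norm_num

/-- [our object] **THE BOND-MIDPOINT INVERSION LAW OF THE PERFECT PROPAGATOR KERNEL**: `PinfKer β γ (−v − e_β + e_γ) = PinfKer β γ v` — the single-axis reflection law
`PinfKer_cflip` composed over the four axes (the reflections compose to `v ↦ −v`, the shifts add up to `−e_β + e_γ`, the signs multiply to `(−1)(−1)`). -/
theorem PinfKer_neg_sub_add (β γ : Fin 4) (v : Site 4) :
    PinfKer (d := 3) β γ (-v - unitVec β + unitVec γ) = PinfKer (d := 3) β γ v := by
  -- the affine single-axis maps `T α y := εy − [β=α]e_α + [γ=α]e_α` and the law `P y = ε_αβ ε_αγ · P (T α y)`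
  set T : Fin 4 → Site 4 → Site 4 := fun α y =>
    axisReflect α y - (if β = α then unitVec α else 0) + (if γ = α then unitVec α else 0) with hT
  have key : ∀ (α : Fin 4) (y : Site 4), PinfKer (d := 3) β γ y = ((reflSign α β * reflSign α γ : ℝ) : ℂ) * PinfKer (d := 3) β γ (T α y) := by
    intro α y
    have h := PinfKer_axisReflect' α β γ (axisReflect α y)
    rwa [axisReflect_axisReflect] at h
  have hTapp : ∀ (α : Fin 4) (y : Site 4) (i : Fin 4),
      T α y i = if i = α then -y i - (if β = α then 1 else 0) + (if γ = α then 1 else 0) else y i := by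
    intro α y i
    simp only [hT, Pi.add_apply, Pi.sub_apply, axisReflect_apply]
    by_cases hi : i = α
    · subst hi
      simp only [if_true]
      by_cases hβ : β = i <;> by_cases hγ : γ = i <;> simp [hβ, hγ, unitVec_apply]
    · simp only [hi, if_false]
      by_cases hβ : β = α <;> by_cases hγ : γ = α <;> simp [hβ, hγ, unitVec_apply, hi]
  have hw : ∀ i : Fin 4, (-v - unitVec β + unitVec γ) i = -v i - (if β = i then 1 else 0) + (if γ = i then 1 else 0) := by
    intro i
    have e1 : (if i = β then (1 : ℤ) else 0) = if β = i then 1 else 0 := by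
      by_cases h : β = i
      · simp [h]
      · simp [h, Ne.symm h]
    have e2 : (if i = γ then (1 : ℤ) else 0) = if γ = i then 1 else 0 := by
      by_cases h : γ = i
      · simp [h]
      · simp [h, Ne.symm h]
    simp only [Pi.add_apply, Pi.sub_apply, Pi.neg_apply, unitVec_apply, e1, e2]
  have e : T 3 (T 2 (T 1 (T 0 (-v - unitVec β + unitVec γ)))) = v := by
    funext i
    by_cases h0 : i = 0
    · subst h0; simp (config := { decide := true }) only [hTapp, hw, if_true, if_false]; ring
    by_cases h1 : i = 1
    · subst h1; simp (config := { decide := true }) only [hTapp, hw, if_true, if_false]; ring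
    by_cases h2 : i = 2
    · subst h2; simp (config := { decide := true }) only [hTapp, hw, if_true, if_false]; ring
    by_cases h3 : i = 3
    · subst h3; simp (config := { decide := true }) only [hTapp, hw, if_true, if_false]; ring
    exfalso
    fin_cases i <;> first | exact h0 rfl | exact h1 rfl | exact h2 rfl | exact h3 rfl
  have hC := prod_reflSign_pair β γ
  rw [Fin.prod_univ_four] at hC
  rw [key 0 (-v - unitVec β + unitVec γ), key 1 (T 0 _), key 2 (T 1 _), key 3 (T 2 _), e]
  calc ((reflSign 0 β * reflSign 0 γ : ℝ) : ℂ) * (((reflSign 1 β * reflSign 1 γ : ℝ) : ℂ) *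
        (((reflSign 2 β * reflSign 2 γ : ℝ) : ℂ) * (((reflSign 3 β * reflSign 3 γ : ℝ) : ℂ) * PinfKer (d := 3) β γ v)))
      = (((reflSign 0 β * reflSign 0 γ : ℝ) : ℂ) * ((reflSign 1 β * reflSign 1 γ : ℝ) : ℂ) *
        ((reflSign 2 β * reflSign 2 γ : ℝ) : ℂ) * ((reflSign 3 β * reflSign 3 γ : ℝ) : ℂ)) * PinfKer (d := 3) β γ v := by ring
    _ = PinfKer (d := 3) β γ v := by rw [hC, one_mul]

section Dictionary

variable (Ψ : LegMap 4 (Fib 3))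

/-- [our object] **`Pker` IS THE STRAIGHT LEG RELABELLED**: `refK Ψ Pkerˢˢ = Pker` — the field block of `Pkerˢˢ` at the shifted legs reads
`Re PinfKer α β ((x − e_α) − (z − e_β)) = Re PinfKer α β (−(z − x) − e_α + e_β) = Re PinfKer α β (z − x)` by `PinfKer_neg_sub_add`; every block touching a
multiplier leg vanishes on both sides (whatever `Ψ` does to multiplier legs). -/
theorem refK_legShift_PkerSwap (hr : ∀ (α : Fin 4) (x : Site 4), Ψ.r (Sum.inl α) x = x - unitVec α) (hs : ∀ a : Fib 3, Ψ.s a = 1) :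
    refK Ψ (fun x z a b => Pker z x a b) = Pker := by
  funext x z a b
  rcases a with α | i <;> rcases b with β | j
  · rw [refK_apply, hs, hs, one_mul, one_mul, hr, hr, Pker_inl_inl, Pker_inl_inl, ← PinfKer_neg_sub_add α β (z - x)]
    congr 2
    abel
  · simp [refK_apply]
  · simp [refK_apply]
  · simp [refK_apply]

/-! ## §2 The resolvent Hessian and the BF polarization at `Pker` over relabelled data ARE the straight ones -/

/-- [our object] **`hessKer Pker (Ψ·V) (Ψ·W) = hessKer Pkerˢˢ V W`** (same difference variable, no flip): the leg relabelling is an automorphism of tadpole and bubble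
for the bounded leg `Pkerˢˢ` (`KernelReflectionBounded`, `bdd_PkerSwap`) and maps `Pkerˢˢ` to `Pker` (§1). -/
theorem hessKer_Pker_legShift (hr : ∀ (α : Fin 4) (x : Site 4), Ψ.r (Sum.inl α) x = x - unitVec α) (hs : ∀ a : Fib 3, Ψ.s a = 1)
    {V : Fin 4 → Site 4 → MKer 4 (Fib 3)} {W : Fin 4 → Site 4 → Fin 4 → Site 4 → MKer 4 (Fib 3)} {Cv Cw δ : ℝ}
    (hδ : 0 < δ) (hV : ∀ (μ : Fin 4) (y : Site 4), BiLoc (V μ y) y y Cv δ)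
    (hW : ∀ (μ : Fin 4) (y : Site 4) (ν : Fin 4) (y' : Site 4), BiLoc (W μ y ν y') y y' Cw δ) (μ ν : Fin 4) (z : Site 4) :
    hessKer Pker (fun μ y => refK Ψ (V μ y)) (fun μ y ν y' => refK Ψ (W μ y ν y')) μ ν z
      = hessKer (fun x z a b => Pker z x a b) V W μ ν z := by
  have h1 := tadpole_refK_bdd Ψ bdd_PkerSwap (hW μ 0 ν z) hδ
  have h2 := bubble_refK_bdd Ψ bdd_PkerSwap (hV μ 0) (hV ν z) hδ
  rw [refK_legShift_PkerSwap Ψ hr hs] at h1 h2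
  unfold ExpKernelCalculus.hessKer
  rw [h1, h2]

/-- [our object] **`PiBF` OVER RELABELLED GLUON DATA IS THE STRAIGHT BF POLARIZATION**:
`PiBF wg wgh (Ψ·V) (Ψ·W) v w μ ν z = wg·hessKer Pkerˢˢ V W μ ν z − wgh·hessKer G0ker v w μ ν z` (the ghost sector is untouched). -/
theorem PiBF_legShift (hr : ∀ (α : Fin 4) (x : Site 4), Ψ.r (Sum.inl α) x = x - unitVec α) (hs : ∀ a : Fib 3, Ψ.s a = 1)
    (wg wgh : ℝ) {V : Fin 4 → Site 4 → MKer 4 (Fib 3)} {W : Fin 4 → Site 4 → Fin 4 → Site 4 → MKer 4 (Fib 3)} {Cv Cw δ : ℝ}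
    (hδ : 0 < δ) (hV : ∀ (μ : Fin 4) (y : Site 4), BiLoc (V μ y) y y Cv δ)
    (hW : ∀ (μ : Fin 4) (y : Site 4) (ν : Fin 4) (y' : Site 4), BiLoc (W μ y ν y') y y' Cw δ)
    (v : Fin 4 → Site 4 → MKer 4 Unit) (w : Fin 4 → Site 4 → Fin 4 → Site 4 → MKer 4 Unit) (μ ν : Fin 4) (z : Site 4) :
    PiBF wg wgh (fun μ y => refK Ψ (V μ y)) (fun μ y ν y' => refK Ψ (W μ y ν y')) v w μ ν z
      = wg * hessKer (fun x z a b => Pker z x a b) V W μ ν z - wgh * hessKer G0ker v w μ ν z := by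
  rw [PiBF_def, hessKer_Pker_legShift Ψ hr hs hδ hV hW]

/-! ## §3 Transport of the gluon-sector letters along the relabelling -/

/-- [folklore] a leg relabelling is additive: `refK Ψ (K − L) = refK Ψ K − refK Ψ L` (any leg map). -/
theorem refK_sub (K L : MKer 4 (Fib 3)) : refK Ψ (K - L) = refK Ψ K - refK Ψ L := by
  funext x z a b
  simp only [refK_apply, Pi.sub_apply, mul_sub]

/-- [folklore] a leg relabelling commutes with finite sums (any leg map). -/
theorem refK_finset_sum {ι : Type*} (s : Finset ι) (K : ι → MKer 4 (Fib 3)) : refK Ψ (∑ i ∈ s, K i) = ∑ i ∈ s, refK Ψ (K i) := by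
  funext x z a b
  simp only [refK_apply, Finset.sum_apply, Finset.mul_sum]

/-- [folklore] **`divV` COMMUTES WITH ANY LEG RELABELLING** (it acts on the base points only): `divV (Ψ·V) y = Ψ·(divV V y)`. -/
theorem divV_refK (V : Fin 4 → Site 4 → MKer 4 (Fib 3)) (y : Site 4) :
    divV (fun μ y => refK Ψ (V μ y)) y = refK Ψ (divV V y) := by
  unfold KernelWard.divV
  rw [refK_finset_sum]
  exact Finset.sum_congr rfl fun μ _ => (refK_sub Ψ _ _).symm

/-- [folklore] **`divW` COMMUTES WITH ANY LEG RELABELLING**: `divW (Ψ·W) y ν y′ = Ψ·(divW W y ν y′)`. -/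
theorem divW_refK (W : Fin 4 → Site 4 → Fin 4 → Site 4 → MKer 4 (Fib 3)) (y : Site 4) (ν : Fin 4) (y' : Site 4) :
    divW (fun μ y ν y' => refK Ψ (W μ y ν y')) y ν y' = refK Ψ (divW W y ν y') := by
  unfold KernelWard.divW
  rw [refK_finset_sum]
  exact Finset.sum_congr rfl fun μ _ => (refK_sub Ψ _ _).symm

/-- [folklore] every leg of the leg-shift relabelling is moved by a translation: `Ψ.r a (x + t) = Ψ.r a x + t`. -/
theorem legShift_r_add (hr : ∀ (α : Fin 4) (x : Site 4), Ψ.r (Sum.inl α) x = x - unitVec α)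
    (hr' : ∀ (j : Fin 4) (x : Site 4), Ψ.r (Sum.inr j) x = x) (a : Fib 3) (x t : Site 4) : Ψ.r a (x + t) = Ψ.r a x + t := by
  rcases a with α | j
  · rw [hr, hr]; abel
  · rw [hr', hr']

/-- [folklore] **THE LEG SHIFT COMMUTES WITH TRANSLATIONS**: `refK Ψ (shiftK t K) = shiftK t (refK Ψ K)`. -/
theorem shiftK_refK_legShift (hr : ∀ (α : Fin 4) (x : Site 4), Ψ.r (Sum.inl α) x = x - unitVec α)
    (hr' : ∀ (j : Fin 4) (x : Site 4), Ψ.r (Sum.inr j) x = x) (t : Site 4) (K : MKer 4 (Fib 3)) :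
    refK Ψ (shiftK t K) = shiftK t (refK Ψ K) := by
  funext x z a b
  show Ψ.s a * Ψ.s b * K (Ψ.r a x + t) (Ψ.r b z + t) a b = Ψ.s a * Ψ.s b * K (Ψ.r a (x + t)) (Ψ.r b (z + t)) a b
  rw [legShift_r_add Ψ hr hr', legShift_r_add Ψ hr hr']

/-- [folklore] **TRANSLATION COVARIANCE TRANSPORTS**: `V μ (y + t) = shiftK (−t) (V μ y)` for all `μ y t` ⟹ the same for `Ψ·V`. -/
theorem cov_refK_legShift (hr : ∀ (α : Fin 4) (x : Site 4), Ψ.r (Sum.inl α) x = x - unitVec α)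
    (hr' : ∀ (j : Fin 4) (x : Site 4), Ψ.r (Sum.inr j) x = x) {V : Fin 4 → Site 4 → MKer 4 (Fib 3)}
    (hcov : ∀ (μ : Fin 4) (y t : Site 4), V μ (y + t) = shiftK (-t) (V μ y)) (μ : Fin 4) (y t : Site 4) :
    refK Ψ (V μ (y + t)) = shiftK (-t) (refK Ψ (V μ y)) := by
  rw [hcov, shiftK_refK_legShift Ψ hr hr']

/-- [folklore] **PAIR TRANSLATION COVARIANCE TRANSPORTS**: `W μ (y + t) ν (y′ + t) = shiftK (−t) (W μ y ν y′)` ⟹ the same for `Ψ·W`. -/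
theorem cov₂_refK_legShift (hr : ∀ (α : Fin 4) (x : Site 4), Ψ.r (Sum.inl α) x = x - unitVec α)
    (hr' : ∀ (j : Fin 4) (x : Site 4), Ψ.r (Sum.inr j) x = x) {W : Fin 4 → Site 4 → Fin 4 → Site 4 → MKer 4 (Fib 3)}
    (hcov : ∀ (μ : Fin 4) (y : Site 4) (ν : Fin 4) (y' t : Site 4), W μ (y + t) ν (y' + t) = shiftK (-t) (W μ y ν y'))
    (μ : Fin 4) (y : Site 4) (ν : Fin 4) (y' t : Site 4) : refK Ψ (W μ (y + t) ν (y' + t)) = shiftK (-t) (refK Ψ (W μ y ν y')) := by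
  rw [hcov, shiftK_refK_legShift Ψ hr hr']

/-- [folklore] `|e_α|₁ = 1`. -/
theorem l1_unitVec (α : Fin 4) : l1 (unitVec α : Site 4) = 1 := by
  have h : ∀ μ : Fin 4, |((unitVec α μ : ℤ) : ℝ)| = if μ = α then 1 else 0 := by
    intro μ
    rw [unitVec_apply]
    split_ifs <;> simp
  unfold B12Sec2to5.l1
  simp only [h, Finset.sum_ite_eq', Finset.mem_univ, if_true]

/-- [folklore] a relabelled leg is at `ℓ¹`-distance at most one from the original: `|Ψ.r a x − p|₁ ≥ |x − p|₁ − 1`. -/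
theorem l1_legShift_sub_ge (hr : ∀ (α : Fin 4) (x : Site 4), Ψ.r (Sum.inl α) x = x - unitVec α)
    (hr' : ∀ (j : Fin 4) (x : Site 4), Ψ.r (Sum.inr j) x = x) (a : Fib 3) (x p : Site 4) : l1 (x - p) - 1 ≤ l1 (Ψ.r a x - p) := by
  rcases a with α | j
  · rw [hr]
    have t := l1_sub_triangle x (x - unitVec α) p
    have e : x - (x - unitVec α) = unitVec α := by abel
    rw [e, l1_unitVec] at t
    linarith
  · rw [hr']
    linarith

/-- [folklore] **BI-LOCALISATION TRANSPORTS** (constant `× e^{2δ}`, same centres, same rate): `BiLoc K p q C δ ⟹ BiLoc (Ψ·K) p q (C·e^{2δ}) δ` for `δ ≥ 0`. -/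
theorem biLoc_refK_legShift (hr : ∀ (α : Fin 4) (x : Site 4), Ψ.r (Sum.inl α) x = x - unitVec α)
    (hr' : ∀ (j : Fin 4) (x : Site 4), Ψ.r (Sum.inr j) x = x) (hs : ∀ a : Fib 3, Ψ.s a = 1)
    {K : MKer 4 (Fib 3)} {p q : Site 4} {C δ : ℝ} (hδ : 0 ≤ δ) (hK : BiLoc K p q C δ) :
    BiLoc (refK Ψ K) p q (C * Real.exp (2 * δ)) δ := by
  intro x z a b
  have hC : 0 ≤ C := hK.nonneg a
  rw [refK_apply, hs, hs, one_mul, one_mul]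
  refine (hK _ _ a b).trans ?_
  rw [mul_assoc, ← Real.exp_add]
  refine mul_le_mul_of_nonneg_left (Real.exp_le_exp.mpr ?_) hC
  have h1 := mul_le_mul_of_nonneg_left (l1_legShift_sub_ge Ψ hr hr' a x p) hδ
  have h2 := mul_le_mul_of_nonneg_left (l1_legShift_sub_ge Ψ hr hr' b z q) hδ
  linarith

/-- [folklore] **ZEROTH FIELD–FIELD MOMENTS ARE RELABELLING-INVARIANT**: `∑'_{(x,z)} (Ψ·K) x z (inl α) (inl β) = ∑'_{(x,z)} K x z (inl α) (inl β)` (re-indexing the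
double series by the product of the two leg translations; no summability needed). -/
theorem tsum_refK_legShift_eq (hr : ∀ (α : Fin 4) (x : Site 4), Ψ.r (Sum.inl α) x = x - unitVec α) (hs : ∀ a : Fib 3, Ψ.s a = 1)
    (K : MKer 4 (Fib 3)) (α β : Fin 4) :
    ∑' p : Pt × Pt, refK Ψ K p.1 p.2 (Sum.inl α) (Sum.inl β) = ∑' p : Pt × Pt, K p.1 p.2 (Sum.inl α) (Sum.inl β) := by
  have e : ∀ p : Pt × Pt, refK Ψ K p.1 p.2 (Sum.inl α) (Sum.inl β)
      = (fun q : Pt × Pt => K q.1 q.2 (Sum.inl α) (Sum.inl β)) (((Equiv.subRight (unitVec α)).prodCongr (Equiv.subRight (unitVec β))) p) := by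
    intro p
    rw [refK_apply, hs, hs, one_mul, one_mul, hr, hr]
    rfl
  rw [tsum_congr e]
  exact ((Equiv.subRight (unitVec α)).prodCongr (Equiv.subRight (unitVec β))).tsum_eq (fun q : Pt × Pt => K q.1 q.2 (Sum.inl α) (Sum.inl β))

/-- [our object] **THE ZEROTH-MOMENT LETTER `h0V` TRANSPORTS VERBATIM.** -/
theorem h0V_legShift (hr : ∀ (α : Fin 4) (x : Site 4), Ψ.r (Sum.inl α) x = x - unitVec α) (hs : ∀ a : Fib 3, Ψ.s a = 1)
    {V : Fin 4 → Site 4 → MKer 4 (Fib 3)}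
    (h0V : ∀ (lam α β : Fin 4), ∑' p : Pt × Pt, V lam 0 p.1 p.2 (Sum.inl α) (Sum.inl β) = 0) (lam α β : Fin 4) :
    ∑' p : Pt × Pt, refK Ψ (V lam 0) p.1 p.2 (Sum.inl α) (Sum.inl β) = 0 := by
  rw [tsum_refK_legShift_eq Ψ hr hs, h0V]

/-- [our object] **THE CUBIC GERM IS RELABELLING-INVARIANT GIVEN THE ZEROTH-MOMENT LETTER**: for a `LocStencil` family `V` with `∑'_{(x,z)} V λ 0 x z (inl α)(inl β) = 0`,
`cubicGermOf (Ψ·V) = cubicGermOf V` — the germ is the list of FIRST leg moments; moving the legs by `e_μ`, `e_ν` adds `[κ=μ]`·(zeroth moment) resp. `[κ=ν]`·(zeroth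
moment), which vanish. -/
theorem cubicGermOf_legShift_of_h0 (hr : ∀ (α : Fin 4) (x : Site 4), Ψ.r (Sum.inl α) x = x - unitVec α) (hs : ∀ a : Fib 3, Ψ.s a = 1)
    {V : Fin 4 → Site 4 → MKer 4 (Fib 3)} {Cv δ : ℝ} (hδ : 0 < δ)
    (hV : ∀ (μ : Fin 4) (y : Site 4), BiLoc (V μ y) y y Cv δ)
    (h0V : ∀ (lam α β : Fin 4), ∑' p : Pt × Pt, V lam 0 p.1 p.2 (Sum.inl α) (Sum.inl β) = 0) :
    cubicGermOf (fun lam y => refK Ψ (V lam y)) = cubicGermOf V := by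
  funext μ ν lam κ i
  unfold WilsonCubicGerm.cubicGermOf
  -- re-index the double series by the product of the two leg translations
  have e : ∀ p : Pt × Pt, refK Ψ (V lam 0) p.1 p.2 (Sum.inl μ) (Sum.inl ν) * (((if i = 0 then p.1 κ else p.2 κ) : ℤ) : ℝ)
      = (fun q : Pt × Pt => V lam 0 q.1 q.2 (Sum.inl μ) (Sum.inl ν) *
          ((((if i = 0 then (q.1 + unitVec μ) κ else (q.2 + unitVec ν) κ) : ℤ) : ℝ)))
          (((Equiv.subRight (unitVec μ)).prodCongr (Equiv.subRight (unitVec ν))) p) := by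
    intro p
    rw [refK_apply, hs, hs, one_mul, one_mul, hr, hr]
    simp only [Equiv.prodCongr_apply, Prod.map_fst, Prod.map_snd, Equiv.subRight_apply, sub_add_cancel]
  rw [tsum_congr e, ((Equiv.subRight (unitVec μ)).prodCongr (Equiv.subRight (unitVec ν))).tsum_eq
    (fun q : Pt × Pt => V lam 0 q.1 q.2 (Sum.inl μ) (Sum.inl ν) * ((((if i = 0 then (q.1 + unitVec μ) κ else (q.2 + unitVec ν) κ) : ℤ) : ℝ)))]
  -- split off the constant part of the weight
  have hsplit : ∀ q : Pt × Pt, V lam 0 q.1 q.2 (Sum.inl μ) (Sum.inl ν) * ((((if i = 0 then (q.1 + unitVec μ) κ else (q.2 + unitVec ν) κ) : ℤ) : ℝ))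
      = V lam 0 q.1 q.2 (Sum.inl μ) (Sum.inl ν) * (((if i = 0 then q.1 κ else q.2 κ) : ℤ) : ℝ)
        + V lam 0 q.1 q.2 (Sum.inl μ) (Sum.inl ν) * (((if i = 0 then unitVec μ κ else unitVec ν κ) : ℤ) : ℝ) := by
    intro q
    by_cases hi : i = 0
    · simp only [hi, if_true, Pi.add_apply, Int.cast_add, mul_add]
    · simp only [hi, if_false, Pi.add_apply, Int.cast_add, mul_add]
  rw [tsum_congr hsplit, (summable_germSummand hV hδ μ ν lam κ i).tsum_add
    ((summable_prod_of_biLoc (hV lam 0) hδ (Sum.inl μ) (Sum.inl ν)).mul_right _), tsum_mul_right, h0V, zero_mul, add_zero]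

/-- [folklore] the pure-gauge first-order vertex of a `LocStencil` family is bi-localised at the base point (constant `4·Cv·(e^{2δ} + 1)`). -/
theorem biLoc_divV {V : Fin 4 → Site 4 → MKer 4 (Fib 3)} {Cv δ : ℝ} (hδ : 0 ≤ δ)
    (hV : ∀ (μ : Fin 4) (y : Site 4), BiLoc (V μ y) y y Cv δ) (y : Site 4) :
    BiLoc (divV V y) y y (∑ _μ : Fin 4, (Cv * Real.exp (2 * δ) + Cv)) δ := by
  have hC : 0 ≤ Cv := (hV 0 y).nonneg (Sum.inl 0)
  have hmem : ∀ μ : Fin 4, BiLoc (V μ (y - unitVec μ) - V μ y) y y (Cv * Real.exp (2 * δ) + Cv) δ := by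
    intro μ x z a b
    have h1 : |V μ (y - unitVec μ) x z a b| ≤ Cv * Real.exp (2 * δ) * Real.exp (-δ * (l1 (x - y) + l1 (z - y))) := by
      refine (hV μ (y - unitVec μ) x z a b).trans ?_
      rw [mul_assoc, ← Real.exp_add]
      refine mul_le_mul_of_nonneg_left (Real.exp_le_exp.mpr ?_) hC
      have t1 := l1_sub_triangle x (y - unitVec μ) y
      have t2 := l1_sub_triangle z (y - unitVec μ) y
      have e : l1 (y - unitVec μ - y) = 1 := by
        rw [ExpKernelCalculus.l1_sub_symm]
        have : y - (y - unitVec μ) = unitVec μ := by abel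
        rw [this, l1_unitVec]
      rw [e] at t1 t2
      have u1 := mul_le_mul_of_nonneg_left t1 hδ
      have u2 := mul_le_mul_of_nonneg_left t2 hδ
      linarith
    have h2 := hV μ y x z a b
    rw [Pi.sub_apply, Pi.sub_apply, Pi.sub_apply, Pi.sub_apply, add_mul]
    exact (abs_sub _ _).trans (add_le_add h1 h2)
  intro x z a b
  unfold KernelWard.divV
  rw [Finset.sum_apply, Finset.sum_apply, Finset.sum_apply, Finset.sum_apply, Finset.sum_mul]
  exact (Finset.abs_sum_le_sum_abs _ _).trans (Finset.sum_le_sum fun μ _ => hmem μ x z a b)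

/-- [our object] **THE WARD LETTER (W1) TRANSPORTS**: the straight law `(Pkerˢˢ ∘ divV V y) ∘ Pkerˢˢ = Pkerˢˢ ∘ X y − X y ∘ Pkerˢˢ` for a `LocStencil` family `V` and
bi-localised generators `X` yields the END's letter at `Pker` for the relabelled data: `(Pker ∘ divV (Ψ·V) y) ∘ Pker = Pker ∘ (Ψ·X y) − (Ψ·X y) ∘ Pker`. -/
theorem hW1_legShift (hr : ∀ (α : Fin 4) (x : Site 4), Ψ.r (Sum.inl α) x = x - unitVec α) (hs : ∀ a : Fib 3, Ψ.s a = 1)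
    {V : Fin 4 → Site 4 → MKer 4 (Fib 3)} {X : Site 4 → MKer 4 (Fib 3)} {Cv Cx δ : ℝ} (hδ : 0 < δ)
    (hV : ∀ (μ : Fin 4) (y : Site 4), BiLoc (V μ y) y y Cv δ) (hX : ∀ y, BiLoc (X y) y y Cx δ)
    (hW1 : ∀ y, comp (comp (fun x z a b => Pker z x a b) (divV V y)) (fun x z a b => Pker z x a b)
      = comp (fun x z a b => Pker z x a b) (X y) - comp (X y) (fun x z a b => Pker z x a b)) (y : Site 4) :
    comp (comp Pker (divV (fun μ y => refK Ψ (V μ y)) y)) Pker = comp Pker (refK Ψ (X y)) - comp (refK Ψ (X y)) Pker := by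
  have hd := biLoc_divV hδ.le hV y
  have hB : (0 : ℝ) ≤ A0P := (abs_nonneg _).trans (bdd_PkerSwap 0 0 (Sum.inl 0) (Sum.inl 0))
  have h := congrArg (refK Ψ) (hW1 y)
  rw [refK_sub, ← comp_refK Ψ (summable_slice_bdd_biLoc bdd_PkerSwap (hX y) hδ), ← comp_refK Ψ (summable_slice_biLoc_bdd (hX y) bdd_PkerSwap hδ),
    ← comp_refK Ψ (summable_slice_rl_bdd (abs_comp_le_of_entryBound hB bdd_PkerSwap hd hδ) bdd_PkerSwap hδ),
    ← comp_refK Ψ (summable_slice_bdd_biLoc bdd_PkerSwap hd hδ), refK_legShift_PkerSwap Ψ hr hs, ← divV_refK] at h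
  exact h

/-- [our object] **THE WARD LETTER (W2) TRANSPORTS**: `divW W y ν y′ = X y ∘ V ν y′ − V ν y′ ∘ X y` (straight) ⟹ the same for `(Ψ·W, Ψ·X, Ψ·V)`. -/
theorem hW2_legShift {V : Fin 4 → Site 4 → MKer 4 (Fib 3)} {W : Fin 4 → Site 4 → Fin 4 → Site 4 → MKer 4 (Fib 3)} {X : Site 4 → MKer 4 (Fib 3)}
    {Cv Cx δ : ℝ} (hδ : 0 < δ) (hV : ∀ (μ : Fin 4) (y : Site 4), BiLoc (V μ y) y y Cv δ) (hX : ∀ y, BiLoc (X y) y y Cx δ)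
    (hW2 : ∀ y ν y', divW W y ν y' = comp (X y) (V ν y') - comp (V ν y') (X y)) (y : Site 4) (ν : Fin 4) (y' : Site 4) :
    divW (fun μ y ν y' => refK Ψ (W μ y ν y')) y ν y' = comp (refK Ψ (X y)) (refK Ψ (V ν y')) - comp (refK Ψ (V ν y')) (refK Ψ (X y)) := by
  have h := congrArg (refK Ψ) (hW2 y ν y')
  rw [refK_sub, ← comp_refK Ψ (summable_slice_biLoc_bdd (hX y) (KernelWard.bdd_of_biLoc (hV ν y') hδ.le) hδ),
    ← comp_refK Ψ (summable_slice_biLoc_bdd (hV ν y') (KernelWard.bdd_of_biLoc (hX y) hδ.le) hδ), ← divW_refK] at h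
  exact h

end Dictionary

end Summit.QuantumFields.BalabanUV.Beta.FP.LegShiftDictionary

end
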